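import Summits.CriticalPhenomena.SAWScalingLimit.Theses.SAWTrackTransport
import Summits.CriticalPhenomena.SAWScalingLimit.Theses.SAWIsotropicAnchor

/-!
# Birth skeleton for crux `RStarRot` (stmt-CriticalPhenomena-7298), route SAWTrackTransport
(shared verbatim with route SAWIsotropicAnchor)

Line `birth`: **disc anchor** — conformal covariance of a chordal family is split at the reference
Dobrushin domain `𝔻 = DobrushinDomain.unitDisc` (marked points `1 = 𝔻.pt 0`, `-1 = 𝔻.pt 1`) into

* `stub_discMoebius` (open; "the Möbius step"): under the R*_rot axioms (chordal,
  restriction-coupled Markov, reversible, covariant under ALL similarities and under conjugation,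
  simple boundary-avoiding) the disc law `μ = P 𝔻` is invariant under the conformal automorphisms
  of `𝔻` fixing the two marked points (the hyperbolic one-parameter group; = dilations of `ℍ`
  fixing `0, ∞`, the one symmetry a bounded-domain family cannot inherit from plane similarities).
  This is the crux's conclusion SPECIALISED to `(𝔻, 𝔻)` — strictly a special case.
* `stub_discTransport` (open; "shape independence"): under the same axioms every law `P D` is the
  image of the disc law under AT LEAST ONE uniformizer `g : 𝔻 → D` (`g(1) = a`, `g(-1) = b` as
  boundary values) pushed through a continuous plane extension `Φ` of `g`. An `∃`-statement: it
  does not say which uniformizer, and says nothing about `𝔻` itself (take `g = id`).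
* `stub_anchorGlue` (known technology, provable now from the tree: Riemann mapping
  `exists_conformalEquiv_ball_holds`, Carathéodory with bijective boundary correspondence
  `JordanDomain.exists_continuousOn_extension_holds`, `ConformalEquiv.trans/symm`): for a CHORDAL
  family, Möbius invariance of the disc law + `∃`-transport ⇒ `IsConformallyCovariant`
  (given `h : D → D'`, uniformizers `g, g'`, the disc automorphism `k = g'⁻¹ ∘ h ∘ g` fixes `±1`;
  `Φ_h ∘ Φ_g` and `Φ_{g'} ∘ Φ_k` agree on `𝔻`, hence on `closure 𝔻`, which carries `μ`).

`RStarRot_of : …Theses.SAWTrackTransport.RStarRot` assembles them into the crux BY NAME (two lines of logic, no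
sorry of its own); `RStarRot_of_isotropicAnchor : …Theses.SAWIsotropicAnchor.RStarRot` is the same assembly for the
shared copy of the item in route SAWIsotropicAnchor (identical body; stmt-CriticalPhenomena-7298 is ONE item wanted by
both routes). Exotic families are thereby sorted into two named types: a non-Möbius-invariant disc law
transported by a similarity-equivariant CHOICE of uniformizer (killed by `stub_discMoebius`), and a
Möbius-invariant disc law with shape-dependent `P D` (killed by `stub_discTransport`).
-/

namespace Summit.CriticalPhenomena.SAWScalingLimit.Cruxes.RStarRot.Birth

open MeasureTheory

/-- stub 1 (open; the Möbius step): the R*_rot axioms force the disc law `P 𝔻` to be invariant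
under every conformal automorphism `g` of the unit disc with boundary values `1 ↦ 1`, `-1 ↦ -1`,
pushed forward along any continuous plane map `Φ` agreeing with `g` on the disc — i.e. the crux's
conclusion `IsConformallyCovariant` specialised to `D = D' = DobrushinDomain.unitDisc`. -/
theorem stub_discMoebius : ∀ P : Literature.Probability.RandomPlanarGeometry.ChordalFamily, P.IsChordal → P.IsRestrictionMarkov → P.IsReversible → P.IsSimilarityCovariant → (∀ D : Literature.Probability.RandomPlanarGeometry.DobrushinDomain, P (D.map Complex.conjLIE.toHomeomorph) = (P D).map (Literature.Probability.RandomPlanarGeometry.CurveClass.map (Complex.conjLIE.toHomeomorph : C(ℂ, ℂ)))) → (∀ D : Literature.Probability.RandomPlanarGeometry.DobrushinDomain, ∀ᵐ γ ∂(P D), γ ∈ Literature.Probability.RandomPlanarGeometry.CurveClass.simple ∧ γ.range ∩ frontier D.carrier ⊆ {D.pt 0, D.pt 1}) → ∀ (g : Literature.Probability.RandomPlanarGeometry.ConformalEquiv Literature.Probability.RandomPlanarGeometry.DobrushinDomain.unitDisc.carrier Literature.Probability.RandomPlanarGeometry.DobrushinDomain.unitDisc.carrier) (Φ : C(ℂ,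 ℂ)), g.HasBoundaryValue (Literature.Probability.RandomPlanarGeometry.DobrushinDomain.unitDisc.pt 0) (Literature.Probability.RandomPlanarGeometry.DobrushinDomain.unitDisc.pt 0) → g.HasBoundaryValue (Literature.Probability.RandomPlanarGeometry.DobrushinDomain.unitDisc.pt 1) (Literature.Probability.RandomPlanarGeometry.DobrushinDomain.unitDisc.pt 1) → Set.EqOn Φ g Literature.Probability.RandomPlanarGeometry.DobrushinDomain.unitDisc.carrier → P Literature.Probability.RandomPlanarGeometry.DobrushinDomain.unitDisc = (P Literature.Probability.RandomPlanarGeometry.DobrushinDomain.unitDisc).map (Literature.Probability.RandomPlanarGeometry.CurveClass.map Φ) := by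
  sorry

/-- stub 2 (open; shape independence, `∃`-form): under the R*_rot axioms, for every Dobrushin
domain `(D; a, b)` there are a uniformizer `g : 𝔻 → D` with boundary values `1 ↦ a`, `-1 ↦ b` and
a continuous plane map `Φ` agreeing with `g` on the disc such that `P D = Φ_* (P 𝔻)`. -/
theorem stub_discTransport : ∀ P : Literature.Probability.RandomPlanarGeometry.ChordalFamily, P.IsChordal → P.IsRestrictionMarkov → P.IsReversible → P.IsSimilarityCovariant → (∀ D : Literature.Probability.RandomPlanarGeometry.DobrushinDomain, P (D.map Complex.conjLIE.toHomeomorph) = (P D).map (Literature.Probability.RandomPlanarGeometry.CurveClass.map (Complex.conjLIE.toHomeomorph : C(ℂ, ℂ)))) → (∀ D : Literature.Probability.RandomPlanarGeometry.DobrushinDomain, ∀ᵐ γ ∂(P D), γ ∈ Literature.Probability.RandomPlanarGeometry.CurveClass.simple ∧ γ.range ∩ frontier D.carrier ⊆ {D.pt 0, D.pt 1}) → ∀ D : Literature.Probability.RandomPlanarGeometry.DobrushinDomain, ∃ (g : Literature.Probability.RandomPlanarGeometry.ConformalEquiv Literature.Probability.RandomPlanarGeometry.DobrushinDomain.unitDisc.carrier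 D.carrier) (Φ : C(ℂ, ℂ)), g.HasBoundaryValue (Literature.Probability.RandomPlanarGeometry.DobrushinDomain.unitDisc.pt 0) (D.pt 0) ∧ g.HasBoundaryValue (Literature.Probability.RandomPlanarGeometry.DobrushinDomain.unitDisc.pt 1) (D.pt 1) ∧ Set.EqOn Φ g Literature.Probability.RandomPlanarGeometry.DobrushinDomain.unitDisc.carrier ∧ P D = (P Literature.Probability.RandomPlanarGeometry.DobrushinDomain.unitDisc).map (Literature.Probability.RandomPlanarGeometry.CurveClass.map Φ) := by
  sorry

/-- stub 3 (known technology; the anchor glue): a CHORDAL family whose disc law is invariant under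
the marked-point-fixing disc automorphisms (conclusion of stub 1) and each of whose laws is the image
of the disc law under some uniformizer (conclusion of stub 2) is conformally covariant. Attack:
for `h : D → D'` with plane extension `Φ_h` and the uniformizers `(g, Φ_g)`, `(g', Φ_{g'})` of stub 2,
`k := g.trans (h.trans g'.symm)` is a disc automorphism with boundary values `±1 ↦ ±1`
(Carathéodory bijectivity for `g'`, tree theorem `JordanDomain.exists_continuousOn_extension_holds`);
a continuous plane extension `Φ_k` exists (same theorem + radial retraction); stub-1 invariance gives
`μ = (Φ_k)_* μ`; `Φ_{g'} ∘ Φ_k = Φ_h ∘ Φ_g` on the disc, hence on its closure, which carries `μ`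
(chordality), so `P D' = (Φ_{g'})_* μ = (Φ_h ∘ Φ_g)_* μ = (Φ_h)_* (P D)` (`Measure.map_map`,
`Measure.map_congr`). -/
theorem stub_anchorGlue : ∀ P : Literature.Probability.RandomPlanarGeometry.ChordalFamily, P.IsChordal → (∀ (g : Literature.Probability.RandomPlanarGeometry.ConformalEquiv Literature.Probability.RandomPlanarGeometry.DobrushinDomain.unitDisc.carrier Literature.Probability.RandomPlanarGeometry.DobrushinDomain.unitDisc.carrier) (Φ : C(ℂ, ℂ)), g.HasBoundaryValue (Literature.Probability.RandomPlanarGeometry.DobrushinDomain.unitDisc.pt 0) (Literature.Probability.RandomPlanarGeometry.DobrushinDomain.unitDisc.pt 0) → g.HasBoundaryValue (Literature.Probability.RandomPlanarGeometry.DobrushinDomain.unitDisc.pt 1) (Literature.Probability.RandomPlanarGeometry.DobrushinDomain.unitDisc.pt 1) → Set.EqOn Φ g Literature.Probability.RandomPlanarGeometry.DobrushinDomain.unitDisc.carrier → P Literature.Probability.RandomPlanarGeometry.DobrushinDomain.unitDisc = (P Literature.Probability.RandomPlanarGeometry.DobrushinDomain.unitDisc).map (Literature.Probability.RandomPlanarGeometry.CurveClass.map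 Φ)) → (∀ D : Literature.Probability.RandomPlanarGeometry.DobrushinDomain, ∃ (g : Literature.Probability.RandomPlanarGeometry.ConformalEquiv Literature.Probability.RandomPlanarGeometry.DobrushinDomain.unitDisc.carrier D.carrier) (Φ : C(ℂ, ℂ)), g.HasBoundaryValue (Literature.Probability.RandomPlanarGeometry.DobrushinDomain.unitDisc.pt 0) (D.pt 0) ∧ g.HasBoundaryValue (Literature.Probability.RandomPlanarGeometry.DobrushinDomain.unitDisc.pt 1) (D.pt 1) ∧ Set.EqOn Φ g Literature.Probability.RandomPlanarGeometry.DobrushinDomain.unitDisc.carrier ∧ P D = (P Literature.Probability.RandomPlanarGeometry.DobrushinDomain.unitDisc).map (Literature.Probability.RandomPlanarGeometry.CurveClass.map Φ)) → P.IsConformallyCovariant := by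
  sorry

/-- Assembly (real proof, no `sorry` of its own): `stub_anchorGlue` applied to the outputs of
`stub_discMoebius` and `stub_discTransport`, each fed the crux hypotheses verbatim; concludes the
route decl `…Theses.SAWTrackTransport.RStarRot` BY NAME (the shared copy
`…Theses.SAWIsotropicAnchor.RStarRot` has the identical body). -/
theorem RStarRot_of : Summit.CriticalPhenomena.SAWScalingLimit.Theses.SAWTrackTransport.RStarRot := by
  intro P hch hmk hrev hsim hconj hsimple
  exact stub_anchorGlue P hch (stub_discMoebius P hch hmk hrev hsim hconj hsimple)
    (stub_discTransport P hch hmk hrev hsim hconj hsimple)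

/-- The same assembly for the shared copy of the crux in route SAWIsotropicAnchor (item
stmt-CriticalPhenomena-7298 is wanted by both routes; the two route decls have identical bodies).
Real proof, no `sorry` of its own; stubs used BY NAME. -/
theorem RStarRot_of_isotropicAnchor : Summit.CriticalPhenomena.SAWScalingLimit.Theses.SAWIsotropicAnchor.RStarRot := by
  intro P hch hmk hrev hsim hconj hsimple
  exact stub_anchorGlue P hch (stub_discMoebius P hch hmk hrev hsim hconj hsimple)
    (stub_discTransport P hch hmk hrev hsim hconj hsimple)

end Summit.CriticalPhenomena.SAWScalingLimit.Cruxes.RStarRot.Birth
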